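import Summits.QuantumFields.BalabanUV.T4Continuum.Support.PerturbationAlgebra
import Literature.MathematicalPhysics.QuantumFieldTheory.Balaban1983to89.T4EtaRateMin

/-!
# T⁴ programme, spine node NE2 (U1a) — THE PERTURBED COVARIANCE IN THE LIAISON CURRENCY: `T4EtaRateMin.LocalRate` INSTANCES for
# the background-dependent species (every `PerturbationLaws` family; the minimal-coupling model), uniform over the data class

Ninth generation of the NE2 prover lineage P1 of the cell `pub-balaban`, file 9.  Generation 8 (`Support/BalabanAveragedTowerUnit`
§4) delivered the cell's liaison shape `T4EtaRateMin.LocalRate` for the `U = 1` species (consecutive levels' entries of the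
unit-lattice covariance differ by `≤ C·θ^k`).  This file delivers the same shape for the BACKGROUND-DEPENDENT species of this
generation, with the background as the DATUM of the readings:

 * §1 `opNorm_pertCov_succ_sub_le`: under `PerturbationLaws … κ e₂` and `‖t‖κ < 1`, `‖c_{k+1}(t) − c_k(t)‖ ≤ Epert(t) k`
   (generation 8's `opNorm_avgTow_succ_sub_le` on `oneStepAveragedLaw_perturbed_king`); geometric form with `Cpert(t)`.
 * §2 **`pertReadings`** (datum = a perturbation family `P` in the class `{P : PerturbationLaws … κ (C₂L^{−k})}`, sites = pairs of
   unit-lattice indices × `Bool`, `loc k P ((i,j),b)` = `Re`/`Im` of `(c_k(t))_{ij}`) and **`localRate_pertCov`**: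
   `LocalRate (pertReadings …) (Cpert κ (2dCst) CJ C₂ 0 t) L⁻¹` — an INSTANCE, uniform over the class, at every admissible coupling.
 * §3 the minimal-coupling model as data: **`mcReadings`** (datum = a pair (𝒜, W) with `LipschitzBackground α β`,
   `BoundedBackground α′ β′`) and **`localRate_minimalCoupling`**.

HONEST FRAMING (T4-DAG p. 1).  Liaison bookkeeping over the results of files 1–8; operator norm ⇒ entrywise; finite torus, linear
layer; the background species are MODELS (abstract perturbation families / abelian-type minimal coupling in a global gauge), not
Bałaban's `Δ_a(U)`; NOT NE3, NOT infinite volume / mass gap / Clay / summit progress; spine 0/9 unchanged.  HONEST DEPENDENCY: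
continuum YM on T⁴ ⇐ BetaPertH ∧ nine spine estimates (0/9 proved); BetaPertH ⇐ (D1) ∧ (D4) ∧ CAP+tail; G-an2-4 gates asym, D1 and
NE2/3/4.  ABSOLUTE RULE kept; no `sorry`.
-/

noncomputable section

open scoped BigOperators ComplexConjugate Matrix Matrix.Norms.L2Operator
open Filter Topology

namespace Summit.QuantumFields.BalabanUV.T4Continuum.PerturbedCovLiaison

open Literature.MathematicalPhysics.QuantumFieldTheory.Balaban1983to89.B5Prop11Plancherel (Cst Cst_nonneg)
open Literature.MathematicalPhysics.QuantumFieldTheory.Balaban1983to89.T4EtaRateMin (Readings LocalRate)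
open Summit.QuantumFields.BalabanUV.T4Continuum
open Summit.QuantumFields.BalabanUV.T4Continuum.CovariantAveragingTower (avgTow opNorm_avgTow_succ_sub_le)
open Summit.QuantumFields.BalabanUV.T4Continuum.BalabanAveragedTowerUnit (idx Qlev opNorm_Qlev_sq_le norm_entry_le_opNorm)
open Summit.QuantumFields.BalabanUV.T4Continuum.BackgroundResolventTower
open Summit.QuantumFields.BalabanUV.T4Continuum.KingPairingPlantedLaw
open Summit.QuantumFields.BalabanUV.T4Continuum.NE2PerturbedLayer
open Summit.QuantumFields.BalabanUV.T4Continuum.FirstOrderBackgroundModel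
open Summit.QuantumFields.BalabanUV.T4Continuum.PerturbationAlgebra

variable {d : ℕ} (L : ℕ) [NeZero L] (M : Fin d → ℕ) [hM : ∀ μ, NeZero (M μ)] (a : ℝ) (ha : 0 < a)

/-! ## §1 Consecutive levels of the perturbed covariance -/

/-- **ONE STEP OF THE PERTURBED TOWER**: `‖c_{k+1}(t) − c_k(t)‖ ≤ Epert(t) k`. [folklore] -/
theorem opNorm_pertCov_succ_sub_le {P : (k : ℕ) → Matrix (idx L M k) (idx L M k) ℂ} {κ : ℝ} {e₂ : ℕ → ℝ}
    (hpert : PerturbationLaws (calDalev L M a ha) P (JpcT L M) κ e₂) {t : ℂ} (ht : ‖t‖ * κ < 1) (k : ℕ) :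
    ‖pertCov L M a ha P t (k + 1) - pertCov L M a ha P t k‖
      ≤ Epert κ (fun k => 2 * d * Cst d a * ((L : ℝ)⁻¹) ^ k) (fun k => CJ d a * ((L : ℝ)⁻¹) ^ k) e₂ (fun _ => 0) t k := by
  have hr : (0 : ℝ) < (L : ℝ) ^ d := pow_pos (by exact_mod_cast Nat.pos_of_ne_zero (NeZero.ne L)) d
  exact opNorm_avgTow_succ_sub_le (Qlev L M) hr (opNorm_Qlev_sq_le L M) _ k (oneStepAveragedLaw_perturbed_king L M a ha hpert ht k)

/-- geometric form: `‖c_{k+1}(t) − c_k(t)‖ ≤ Cpert(t)·L^{−k}` when `e₂ k = C₂L^{−k}`. [folklore] -/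
theorem opNorm_pertCov_succ_sub_le_geom {P : (k : ℕ) → Matrix (idx L M k) (idx L M k) ℂ} {κ C₂ : ℝ}
    (hpert : PerturbationLaws (calDalev L M a ha) P (JpcT L M) κ (fun k => C₂ * ((L : ℝ)⁻¹) ^ k)) {t : ℂ} (ht : ‖t‖ * κ < 1)
    (k : ℕ) :
    ‖pertCov L M a ha P t (k + 1) - pertCov L M a ha P t k‖ ≤ Cpert κ (2 * d * Cst d a) (CJ d a) C₂ 0 t * ((L : ℝ)⁻¹) ^ k := by
  refine (opNorm_pertCov_succ_sub_le L M a ha hpert ht k).trans ?_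
  refine Epert_le_Cpert ht (fun k => le_rfl) (fun k => le_rfl) (fun k => le_rfl) (fun k => ?_) k
  simp only [zero_mul, le_refl]

/-! ## §2 The liaison readings of the perturbed species and their `LocalRate` -/

/-- THE READINGS of the perturbed unit-lattice covariance at coupling `t`: datum = a perturbation family of Bałaban's free operators
in the class `PerturbationLaws … κ (C₂L^{−k})`; sites = pairs of unit-lattice indices × `Bool` (real / imaginary part); the scalar
reading and the volume factor are unused (`0`). [folklore] -/
def pertReadings (κ C₂ : ℝ) (t : ℂ) :
    Readings ((k : ℕ) → Matrix (idx L M k) (idx L M k) ℂ) ((idx L M 0 × idx L M 0) × Bool) where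
  dom := {P | PerturbationLaws (calDalev L M a ha) P (JpcT L M) κ (fun k => C₂ * ((L : ℝ)⁻¹) ^ k)}
  act := fun _ _ => 0
  loc := fun k P x => if x.2 then ((pertCov L M a ha P t k) x.1.1 x.1.2).re else ((pertCov L M a ha P t k) x.1.1 x.1.2).im
  vol := 0
  vol_nonneg := le_rfl

/-- **THE SHAPE `LocalRate` HOLDS FOR THE PERTURBED SPECIES**, uniformly over the class: consecutive levels' entries of `c_k(t)`
differ by at most `Cpert(t)·L^{−k}` for every admissible perturbation family and every `‖t‖κ < 1` — an INSTANCE (a theorem);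
the background dependence is carried by the datum. [cite: King1986, Lemma 4.5 (4.38) p.674 (shape)] [folklore] -/
theorem localRate_pertCov (κ C₂ : ℝ) {t : ℂ} (ht : ‖t‖ * κ < 1) :
    LocalRate (pertReadings L M a ha κ C₂ t) (Cpert κ (2 * d * Cst d a) (CJ d a) C₂ 0 t) ((L : ℝ)⁻¹) := by
  intro k P hP x
  have hent : ‖(pertCov L M a ha P t (k + 1) - pertCov L M a ha P t k) x.1.1 x.1.2‖
      ≤ Cpert κ (2 * d * Cst d a) (CJ d a) C₂ 0 t * ((L : ℝ)⁻¹) ^ k :=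
    (norm_entry_le_opNorm _ _ _).trans (opNorm_pertCov_succ_sub_le_geom L M a ha hP ht k)
  rw [Matrix.sub_apply] at hent
  obtain ⟨⟨i, j⟩, b⟩ := x
  cases b with
  | true =>
    simp only [pertReadings, ↓reduceIte]
    rw [← Complex.sub_re]
    exact (Complex.abs_re_le_norm _).trans hent
  | false =>
    simp only [pertReadings, Bool.false_eq_true, ↓reduceIte]
    rw [← Complex.sub_im]
    exact (Complex.abs_im_le_norm _).trans hent

/-! ## §3 The minimal-coupling model as data -/

/-- THE READINGS of the minimal-coupling species: datum = a pair (first-order Lipschitz background `𝒜`, bounded consistent potential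
`W`) in the class `LipschitzBackground α β × BoundedBackground α′ β′`. [folklore] -/
def mcReadings (α β α' β' : ℝ) (t : ℂ) :
    Readings (((k : ℕ) → Fin d → (idx L M k → ℂ)) × ((k : ℕ) → (idx L M k → ℂ))) ((idx L M 0 × idx L M 0) × Bool) where
  dom := {VW | LipschitzBackground L M VW.1 α β ∧ BoundedBackground L M VW.2 α' β'}
  act := fun _ _ => 0
  loc := fun k VW x =>
    if x.2 then ((pertCov L M a ha (Pmc L M VW.1 VW.2) t k) x.1.1 x.1.2).re
    else ((pertCov L M a ha (Pmc L M VW.1 VW.2) t k) x.1.1 x.1.2).im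
  vol := 0
  vol_nonneg := le_rfl

/-- **`LocalRate` FOR THE MINIMAL-COUPLING SPECIES** (`d ≥ 1`), uniformly over the data class, at every coupling `‖t‖κ < 1`,
`κ = (d(α + β) + α′)Cst`: constant `Cpert(t)` with `C₂ = dCst²(Lβ + 2d(L + 1)α) + Cst²β′`.  An INSTANCE; the background is the datum.
[cite: King1986, Lemma 4.5 (4.38) p.674 (shape)] [folklore] -/
theorem localRate_minimalCoupling (hd : 1 ≤ d) (α β α' β' : ℝ) {t : ℂ} (ht : ‖t‖ * kappaMC d a α β α' < 1) :
    LocalRate (mcReadings L M a ha α β α' β' t)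
      (Cpert (kappaMC d a α β α') (2 * d * Cst d a) (CJ d a) (C2MC d L a α β β') 0 t) ((L : ℝ)⁻¹) := by
  intro k VW hVW x
  have hP := perturbationLaws_minimalCoupling L M a ha hd hVW.1 hVW.2
  have hent : ‖(pertCov L M a ha (Pmc L M VW.1 VW.2) t (k + 1) - pertCov L M a ha (Pmc L M VW.1 VW.2) t k) x.1.1 x.1.2‖
      ≤ Cpert (kappaMC d a α β α') (2 * d * Cst d a) (CJ d a) (C2MC d L a α β β') 0 t * ((L : ℝ)⁻¹) ^ k :=
    (norm_entry_le_opNorm _ _ _).trans (opNorm_pertCov_succ_sub_le_geom L M a ha hP ht k)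
  rw [Matrix.sub_apply] at hent
  obtain ⟨⟨i, j⟩, b⟩ := x
  cases b with
  | true =>
    simp only [mcReadings, ↓reduceIte]
    rw [← Complex.sub_re]
    exact (Complex.abs_re_le_norm _).trans hent
  | false =>
    simp only [mcReadings, Bool.false_eq_true, ↓reduceIte]
    rw [← Complex.sub_im]
    exact (Complex.abs_im_le_norm _).trans hent

end Summit.QuantumFields.BalabanUV.T4Continuum.PerturbedCovLiaison

end
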